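import Literature.AlgebraicGeometry.Motives.HodgeThetaSubalgebraSymplecticRankSix
import Mathlib.LinearAlgebra.Trace
import Mathlib.LinearAlgebra.Projection
import HarnessLib

/-!
# The Θ-subalgebra theorem in rank six, PART 3b′: the trace form of the E³-type skeleton

Family `hodge`, layer `Literature/AlgebraicGeometry/Motives`. Research context: cell `pub-hodge-ring2` (HONEST
FRAMING: research route conditional on HC_CM; not a corollary; Q11.4-sentence-2 already refuted in dim ≥ 3),
Literature lane, programme R13 «generic abelian threefolds» (Moonen–Zarhin 1999 (2.3) Type I(1)). UNCONDITIONAL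
linear algebra; theorem only, no definition, no named fact (D-0026), no `sorry`.

CONTEXT. Companion of `…RankSixKilling` (the Killing form `κ` of the E³-type skeleton
`𝔊 = ⟨C₁,T,B₀⟩ ⊕ ⟨S,E′,F′⟩`). Here the TRACE FORM `β(X,Y) = tr_M(XY)` of the six-dimensional standard module
`M = P ⊕ Q` is computed on the same pairs (`skeleton_traceForm`): `β(S,S) = 4e²`, `β(B₀,C₁) = β(C₁,B₀) = 3`
(`B₀C₁` is the projection onto `P`, `dim P = 3`), `β(S,E′) = β(S,F′) = β(T,B₀) = β(B₀,B₀) = β(T,C₁) = β(C₁,C₁) = 0`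
and `β(s,C₁) = β(s,T) = β(s,B₀) = 0` for every `s` commuting with `B₀` and `C₁`. With PART 3b this gives
`β = 2κ` on `𝔰 × 𝔊` and `β ≠ 2κ` on `𝔞₁` (`3 ≠ 8`), i.e. `Rad(β − 2κ) = 𝔰` — the invariant that PART 3c descends
to `ℚ`. Inputs are the outputs of PART 3a (`skeleton_spectral`, `skeleton_triple`): the `S`-eigenbasis
`p₊, p₀, p₋` of `P` and the matrices of `E′, F′` (`E′p₀ = p₊`, `E′p₋ = −r p₀`, `F′p₊ = p₀`, `F′p₀ = −r′p₋`,
`rr′ = 1`). Method: `tr(SE′) = e⁻¹ tr(S[S,E′]) = 0`, `tr(S²) = e·tr(S[E′,F′]) = e² tr(E′F′)` by cyclicity, and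
`E′F′` is the projection onto `⟨p₊, p₀, C₁p₊, C₁p₀⟩` (`LinearMap.IsProj.trace`).

## References

* [MoonenZarhin1999LowDim] B. Moonen, Yu. Zarhin, Math. Ann. 315 (1999), §2 (2.3), (2.5).
* [Humphreys1972] J. E. Humphreys, Introduction to Lie algebras and representation theory, GTM 9 (1972), §4.3
  (trace forms of representations, associativity `tr([x,y]z) = tr(x[y,z])`), §5.1.
-/

namespace Literature.AlgebraicGeometry.Motives

namespace HodgeStructure

variable {M : Type*} [AddCommGroup M] [Module ℂ M]

/-- **The trace form of the E³-type skeleton** (PART 3b′ of the rank-six Θ-subalgebra theorem). With `T` the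
involution `B₀C₁ − C₁B₀` (`P`/`Q` its `±1`-eigenspaces, `dim P = 3`, `B₀C₁|_P = 1`, `C₁B₀|_Q = 1`), `S, E′, F′`
commuting with `C₁`, `[S,E′] = eE′`, `[S,F′] = −eF′`, `[E′,F′] = e⁻¹S`, and the spectral data of PART 3a
(`Sp₊ = ep₊`, `Sp₀ = 0`, `Sp₋ = −ep₋`, `E′p₀ = p₊`, `E′p₋ = −rp₀`, `F′p₊ = p₀`, `F′p₀ = −r′p₋`, `F′p₋ = 0`,
`rr′ = 1`): `tr(S²) = 4e²`, `tr(SE′) = tr(SF′) = 0`, `tr(B₀C₁) = tr(C₁B₀) = 3`,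
`tr(TB₀) = tr(B₀²) = tr(TC₁) = tr(C₁²) = 0`, and `tr(sC₁) = tr(sT) = tr(sB₀) = 0` for every `s` commuting with
`B₀` and `C₁`. [cite: Humphreys1972, §4.3 (trace form of a representation; associativity), §5.1];
[cite: MoonenZarhin1999LowDim, §2 (2.3), (2.5)] -/
theorem SymplecticThetaSix.skeleton_traceForm [FiniteDimensional ℂ M]
    {T B₀ C₁ : Module.End ℂ M} {P Q : Submodule ℂ M}
    (hP : ∀ x ∈ P, T x = x) (hQ : ∀ x ∈ Q, T x = -x)
    (hPmem : ∀ v, (2 : ℂ)⁻¹ • (v + T v) ∈ P) (hQmem : ∀ v, (2 : ℂ)⁻¹ • (v - T v) ∈ Q)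
    (hP3 : Module.finrank ℂ ↥P = 3)
    (hB₀P : ∀ p ∈ P, B₀ p = 0) (hB₀im : ∀ v, B₀ v ∈ P) (hC₁Q : ∀ q ∈ Q, C₁ q = 0) (hC₁im : ∀ v, C₁ v ∈ Q)
    (hBC : ∀ p ∈ P, B₀ (C₁ p) = p) (hCB : ∀ q ∈ Q, C₁ (B₀ q) = q) (hTBC : T = B₀ * C₁ - C₁ * B₀)
    {S E' F' : Module.End ℂ M} (hEC : E' * C₁ = C₁ * E') (hFC : F' * C₁ = C₁ * F')
    {e : ℂ} (he : e ≠ 0) (hSE : S * E' - E' * S = e • E') (hSF : S * F' - F' * S = -(e • F'))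
    (hEF : E' * F' - F' * E' = e⁻¹ • S)
    {pu pz pd : M} (hpuP : pu ∈ P) (hpzP : pz ∈ P) (hpdP : pd ∈ P) (hpu0 : pu ≠ 0) (hpz0 : pz ≠ 0)
    (hpd0 : pd ≠ 0) (hSpu : S pu = e • pu) (hSpz : S pz = 0) (hSpd : S pd = (-e) • pd)
    {r r' : ℂ} (hrr : r * r' = 1) (hEpz : E' pz = pu) (hEpd : E' pd = (-r) • pz)
    (hFpu : F' pu = pz) (hFpz : F' pz = (-r') • pd) (hFpd : F' pd = 0) :
    LinearMap.trace ℂ M (S * S) = 4 * e ^ 2 ∧ LinearMap.trace ℂ M (S * E') = 0 ∧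
    LinearMap.trace ℂ M (S * F') = 0 ∧ LinearMap.trace ℂ M (B₀ * C₁) = 3 ∧ LinearMap.trace ℂ M (C₁ * B₀) = 3 ∧
    LinearMap.trace ℂ M (T * B₀) = 0 ∧ LinearMap.trace ℂ M (B₀ * B₀) = 0 ∧ LinearMap.trace ℂ M (T * C₁) = 0 ∧
    LinearMap.trace ℂ M (C₁ * C₁) = 0 ∧
    (∀ s : Module.End ℂ M, s * C₁ = C₁ * s → s * B₀ = B₀ * s →
      LinearMap.trace ℂ M (s * C₁) = 0 ∧ LinearMap.trace ℂ M (s * T) = 0 ∧ LinearMap.trace ℂ M (s * B₀) = 0) := by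
  -- square-zero operators
  have hBB : B₀ * B₀ = 0 := by ext v; exact hB₀P _ (hB₀im v)
  have hCC : C₁ * C₁ = 0 := by ext v; exact hC₁Q _ (hC₁im v)
  have htr0 : ∀ X : Module.End ℂ M, X * X = 0 → LinearMap.trace ℂ M X = 0 := fun X hX =>
    (LinearMap.isNilpotent_trace_of_isNilpotent ⟨2, by rw [pow_two, hX]⟩).eq_zero
  have htrB : LinearMap.trace ℂ M B₀ = 0 := htr0 B₀ hBB
  have htrC : LinearMap.trace ℂ M C₁ = 0 := htr0 C₁ hCC
  -- `TB₀ = B₀`, `TC₁ = −C₁`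
  have hTB : T * B₀ = B₀ := by ext v; exact hP _ (hB₀im v)
  have hTC : T * C₁ = -C₁ := by ext v; exact hQ _ (hC₁im v)
  -- `B₀C₁` is the projection onto `P`
  have hproj : LinearMap.IsProj P (B₀ * C₁) := ⟨fun v => hB₀im (C₁ v), fun p hp => hBC p hp⟩
  have κBC : LinearMap.trace ℂ M (B₀ * C₁) = 3 := by rw [hproj.trace, hP3]; norm_num
  have κCB : LinearMap.trace ℂ M (C₁ * B₀) = 3 := by rw [LinearMap.trace_mul_comm, κBC]
  -- mixed pairs
  have hmixed : ∀ s : Module.End ℂ M, s * C₁ = C₁ * s → s * B₀ = B₀ * s →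
      LinearMap.trace ℂ M (s * C₁) = 0 ∧ LinearMap.trace ℂ M (s * T) = 0 ∧
        LinearMap.trace ℂ M (s * B₀) = 0 := by
    intro s hsC hsB
    refine ⟨htr0 _ ?_, ?_, htr0 _ ?_⟩
    · rw [mul_assoc, ← mul_assoc C₁ s, ← hsC, mul_assoc, hCC, mul_zero, mul_zero]
    · rw [hTBC, mul_sub, map_sub, ← mul_assoc, ← mul_assoc, LinearMap.trace_mul_comm ℂ (s * B₀) C₁,
        ← mul_assoc, ← hsC, sub_self]
    · rw [mul_assoc, ← mul_assoc B₀ s, ← hsB, mul_assoc, hBB, mul_zero, mul_zero]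
  -- `tr(SE′) = tr(SF′) = 0` by cyclicity
  have κSE : LinearMap.trace ℂ M (S * E') = 0 := by
    have h1 : S * E' = e⁻¹ • (S * (S * E') - S * (E' * S)) := by
      rw [← mul_sub, hSE, mul_smul_comm, smul_smul, inv_mul_cancel₀ he, one_smul]
    rw [h1, map_smul, map_sub, ← mul_assoc S E' S, LinearMap.trace_mul_comm ℂ (S * E') S, sub_self,
      smul_zero]
  have κSF : LinearMap.trace ℂ M (S * F') = 0 := by
    have h1 : S * F' = -(e⁻¹ • (S * (S * F') - S * (F' * S))) := by
      rw [← mul_sub, hSF, mul_neg, smul_neg, neg_neg, mul_smul_comm, smul_smul, inv_mul_cancel₀ he, one_smul]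
    rw [h1, map_neg, map_smul, map_sub, ← mul_assoc S F' S, LinearMap.trace_mul_comm ℂ (S * F') S, sub_self,
      smul_zero, neg_zero]
  -- `tr(S²) = e² tr(E′F′)`
  have κSS' : LinearMap.trace ℂ M (S * S) = e ^ 2 * LinearMap.trace ℂ M (E' * F') := by
    have h1 : S = e • (E' * F' - F' * E') := by
      rw [hEF, smul_smul, mul_inv_cancel₀ he, one_smul]
    have h2 : S * S = e • (S * E' * F' - S * F' * E') := by
      calc S * S = S * (e • (E' * F' - F' * E')) := by rw [← h1]
        _ = e • (S * E' * F' - S * F' * E') := by rw [mul_smul_comm, mul_sub, mul_assoc, mul_assoc]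
    have hES : E' * S = S * E' - e • E' := by rw [← hSE]; abel
    have h3 : LinearMap.trace ℂ M (S * F' * E') =
        LinearMap.trace ℂ M (S * E' * F') - e * LinearMap.trace ℂ M (E' * F') := by
      rw [LinearMap.trace_mul_comm ℂ (S * F') E', ← mul_assoc, hES, sub_mul, map_sub, smul_mul_assoc, map_smul,
        smul_eq_mul]
    rw [h2, map_smul, map_sub, h3, smul_eq_mul]
    ring
  -- `E′F′` is the projection onto `L = ⟨p₊, p₀, C₁p₊, C₁p₀⟩`
  have hEFC : E' * F' * C₁ = C₁ * (E' * F') := by rw [mul_assoc, hFC, ← mul_assoc, hEC, mul_assoc]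
  have hEFpu : (E' * F') pu = pu := by rw [Module.End.mul_apply, hFpu, hEpz]
  have hEFpz : (E' * F') pz = pz := by
    rw [Module.End.mul_apply, hFpz, map_smul, hEpd, smul_smul, show -r' * -r = r * r' by ring, hrr, one_smul]
  have hEFpd : (E' * F') pd = 0 := by rw [Module.End.mul_apply, hFpd, map_zero]
  have hEFC' : ∀ v, (E' * F') (C₁ v) = C₁ ((E' * F') v) := fun v => by
    rw [← Module.End.mul_apply, hEFC, Module.End.mul_apply]
  -- independence of the eigenbasis of `P` and `P = ⟨p₊, p₀, p₋⟩`
  have hli : LinearIndependent ℂ ![pu, pz, pd] := by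
    rw [Fintype.linearIndependent_iff]
    intro g hg
    rw [Fin.sum_univ_three] at hg
    simp only [Matrix.cons_val_zero, Matrix.cons_val_one, Matrix.cons_val_two, Matrix.tail_cons,
      Matrix.head_cons] at hg
    have hB := congrArg (fun x => S x) hg
    simp only [map_add, map_smul, hSpu, hSpz, hSpd, map_zero, smul_zero, add_zero, smul_smul] at hB
    have hC := congrArg (fun x => S x) hB
    simp only [map_add, map_smul, hSpu, hSpd, map_zero, smul_smul] at hC
    have hg0 : g 0 = 0 := by
      have e1 : (2 * e ^ 2 * g 0) • pu = 0 := by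
        have e2 : (2 * e ^ 2 * g 0) • pu =
            e • ((g 0 * e) • pu + (g 2 * -e) • pd) + ((g 0 * e * e) • pu + (g 2 * -e * -e) • pd) := by
          module
        rw [e2, hB, hC, smul_zero, add_zero]
      have h1 := (smul_eq_zero.1 e1).resolve_right hpu0
      exact (mul_eq_zero.1 h1).resolve_left (mul_ne_zero two_ne_zero (pow_ne_zero 2 he))
    rw [hg0] at hB
    simp only [zero_mul, zero_smul, zero_add] at hB
    have hg2 : g 2 = 0 := by
      have h1 := (smul_eq_zero.1 hB).resolve_right hpd0
      exact (mul_eq_zero.1 h1).resolve_right (neg_ne_zero.2 he)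
    rw [hg0, hg2, zero_smul, zero_smul, zero_add, add_zero] at hg
    have hg1 : g 1 = 0 := (smul_eq_zero.1 hg).resolve_right hpz0
    intro i
    fin_cases i <;> assumption
  have hcoord : ∀ y ∈ P, ∃ a b c : ℂ, y = a • pu + b • pz + c • pd := by
    have hle : Submodule.span ℂ (Set.range ![pu, pz, pd]) ≤ P := by
      rw [Submodule.span_le]
      rintro _ ⟨i, rfl⟩
      fin_cases i
      · exact hpuP
      · exact hpzP
      · exact hpdP
    have heq : Submodule.span ℂ (Set.range ![pu, pz, pd]) = P :=
      Submodule.eq_of_le_of_finrank_eq hle (by rw [finrank_span_eq_card hli, hP3]; simp)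
    intro y hy
    have hy' : y ∈ Submodule.span ℂ (Set.range ![pu, pz, pd]) := by rw [heq]; exact hy
    obtain ⟨c, hc⟩ := (Submodule.mem_span_range_iff_exists_fun ℂ).1 hy'
    refine ⟨c 0, c 1, c 2, ?_⟩
    rw [← hc, Fin.sum_univ_three]
    simp
  -- the four vectors `p₊, p₀, C₁p₊, C₁p₀` are independent
  have hli2 : ∀ a b : ℂ, a • pu + b • pz = 0 → a = 0 ∧ b = 0 := by
    intro a b hab
    have hli' := hli
    rw [Fintype.linearIndependent_iff] at hli'
    have h := hli' ![a, b, 0] (by rw [Fin.sum_univ_three]; simp [hab])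
    exact ⟨h 0, h 1⟩
  have hli4 : LinearIndependent ℂ ![pu, pz, C₁ pu, C₁ pz] := by
    rw [Fintype.linearIndependent_iff]
    intro g hg
    rw [Fin.sum_univ_four] at hg
    simp only [Matrix.cons_val] at hg
    have hB := congrArg (fun x => B₀ x) hg
    simp only [map_add, map_smul, hB₀P pu hpuP, hB₀P pz hpzP, hBC pu hpuP, hBC pz hpzP, map_zero, smul_zero,
      zero_add] at hB
    obtain ⟨h2, h3⟩ := hli2 _ _ hB
    rw [h2, h3, zero_smul, zero_smul, add_zero, add_zero] at hg
    obtain ⟨h0, h1⟩ := hli2 _ _ hg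
    intro i
    fin_cases i <;> assumption
  set L : Submodule ℂ M := Submodule.span ℂ (Set.range ![pu, pz, C₁ pu, C₁ pz]) with hL
  have hLrank : Module.finrank ℂ ↥L = 4 := by rw [hL, finrank_span_eq_card hli4]; simp
  have hpuL : pu ∈ L := Submodule.subset_span ⟨0, rfl⟩
  have hpzL : pz ∈ L := Submodule.subset_span ⟨1, rfl⟩
  have hCpuL : C₁ pu ∈ L := Submodule.subset_span ⟨2, rfl⟩
  have hCpzL : C₁ pz ∈ L := Submodule.subset_span ⟨3, rfl⟩
  have hEFP : ∀ y ∈ P, ∃ a b : ℂ, (E' * F') y = a • pu + b • pz := by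
    intro y hy
    obtain ⟨a, b, c, rfl⟩ := hcoord y hy
    exact ⟨a, b, by simp only [map_add, map_smul, hEFpu, hEFpz, hEFpd, smul_zero, add_zero]⟩
  have hprojEF : LinearMap.IsProj L (E' * F') := by
    constructor
    · intro v
      have hv : v = (2 : ℂ)⁻¹ • (v + T v) + (2 : ℂ)⁻¹ • (v - T v) := by module
      obtain ⟨a, b, hab⟩ := hEFP _ (hPmem v)
      obtain ⟨a', b', hab'⟩ := hEFP _ (hB₀im ((2 : ℂ)⁻¹ • (v - T v)))
      have hq : (E' * F') ((2 : ℂ)⁻¹ • (v - T v)) = a' • C₁ pu + b' • C₁ pz := by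
        rw [← hCB _ (hQmem v), hEFC', hab', map_add, map_smul, map_smul]
      rw [hv, map_add, hab, hq]
      exact Submodule.add_mem _ (Submodule.add_mem _ (Submodule.smul_mem _ _ hpuL) (Submodule.smul_mem _ _ hpzL))
        (Submodule.add_mem _ (Submodule.smul_mem _ _ hCpuL) (Submodule.smul_mem _ _ hCpzL))
    · intro v hv
      obtain ⟨c, hc⟩ := (Submodule.mem_span_range_iff_exists_fun ℂ).1 hv
      rw [← hc, Fin.sum_univ_four]
      simp only [Matrix.cons_val, map_add, map_smul, hEFpu, hEFpz, hEFC']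
  have κEF : LinearMap.trace ℂ M (E' * F') = 4 := by rw [hprojEF.trace, hLrank]; norm_num
  have κSS : LinearMap.trace ℂ M (S * S) = 4 * e ^ 2 := by rw [κSS', κEF]; ring
  exact ⟨κSS, κSE, κSF, κBC, κCB, by rw [hTB, htrB], by rw [hBB, map_zero], by rw [hTC, map_neg, htrC, neg_zero],
    by rw [hCC, map_zero], hmixed⟩

end HodgeStructure

end Literature.AlgebraicGeometry.Motives
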